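import Summits.AtomisticToContinuum.BoseEinsteinCondensation.Theses.BECStoquasticCensoring
import HarnessLib

/-!
# Birth skeleton for crux `CountViolationGapU` (stmt-AtomisticToContinuum-14966, route `BECStoquasticCensoring`)

**The crux** (`Theses/BECStoquasticCensoring.lean`, `def CountViolationGapU`, rank 3, XL): for every
repulsive finite-range `v` there are `K₀`, `ρ₀ > 0` such that for every `0 < ρ < ρ₀` there is
`c₀ = c₀(ρ) > 0` with: eventually in `N`, for every `K₀ ≤ K ≤ log N` (`a` = scattering length,
`ℓ = K (ρa)^{-1/2}`, `L = (N/ρ)^{1/3}`, `3ℓ ≤ L`), every interior cell `Q = x₀ + [0,ℓ)³` and every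
`1 ≤ M ≤ √(ρℓ³)`, every Dirichlet trial state `Φ` vanishing on the count window
`W = {X : |N_Q(X) − ρℓ³| ≤ M√(ρℓ³)}` has `E₀(N,L) + c₀·a·ρ·M² ≤ ⟨Φ, H Φ⟩`.

**The cut (birth certificate BC3, planner skeleton `Lines/birth.lean`).** A trial state vanishing on
the window lives on the disjoint union of the OVERFULL configurations `{N_Q − ρℓ³ > M√(ρℓ³)}`
(compression of the cell) and the UNDERFULL ones `{N_Q − ρℓ³ < −M√(ρℓ³)}` (rarefaction, down to the
void corner `M = √(ρℓ³)`). The two violation mechanisms are physically distinct (squeezing `Δ = M√n̄`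
extra particles into `Q` versus expelling them; at the corner: double density versus a vacuum bubble of
side `ℓ ≫ ξ`), and the analytic fact that lets one treat them separately is a support-splitting lemma
for `C¹` Dirichlet states. Three registered stubs:

* `stub_supportSplit` (M; analysis, `v`-independent): a `C¹` normalised Dirichlet state `Φ` vanishing on
  the window `{|N_Q − n̄| ≤ Δ}`, `Δ ≥ 1`, has energy at least the minimum of the two ONE-SIDED
  variational infima (over states vanishing off the overfull set, resp. off the underfull set).
  Proof idea: `Φ = Φ₊ + Φ₋` with `Φ₊ = Φ·1_{overfull}`, `Φ₋ = Φ·1_{underfull}`; the closures of the two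
  sets meet only at configurations with `≥ 2` particles on `∂Q`, which are accumulation points of OPEN
  window regions (some in/out pattern of the boundary particles realises a window count because the band
  `[n̄ − Δ, n̄ + Δ]` contains an integer), so `Φ` and `DΦ` vanish there and both pieces are `C¹`,
  Dirichlet, Bose-symmetric (`N_Q` is permutation invariant), with `|Φ|² = |Φ₊|² + |Φ₋|²` and
  `|∇Φ|² = |∇Φ₊|² + |∇Φ₋|²` pointwise; normalising the nonzero pieces,
  `⟨Φ,HΦ⟩ = p·⟨Φ̂₊,HΦ̂₊⟩ + (1 − p)·⟨Φ̂₋,HΦ̂₋⟩ ≥ min(inf₊, inf₋)`.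
* `stub_overfullGap` (XL; COMPRESSION COST, the crux restricted to states supported in the overfull
  set, same quantifier prefix and constants-after-`ρ` discipline as the repaired crux): expected value
  `Δ²/(2χ_Q) = 4πaρM²`, `χ_Q = ℓ³/(8πa)`; the intended tool is the ground-state transform
  `⟨FΨ₀,(H − E₀)FΨ₀⟩ = ∫|∇F|²Ψ₀²` (rate at which the ground-state diffusion started from overfull
  configurations re-enters the window), NOT energy asymptotics (the increment is below LHY precision).
* `stub_underfullGap` (XL; RAREFACTION / VOID COST, the crux restricted to states supported in the
  underfull set): same expected constant by convexity of `e(ρ) = 4πaρ²` (first-order terms cancel by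
  chemical-potential balance; at the void corner the cost is `4πaρ²ℓ³ = 4πaρM²` plus a positive kinetic
  surface term); the hard case is the void corner with hard cores.

`CountViolationGapU_of` (kernel-checked, no `sorry`): `K₀ = max`, `ρ₀ = min`, `c₀(ρ) = min(c₊(ρ), c₋(ρ))`,
intersect the two eventualities in `N`, split the support of `Φ` by `stub_supportSplit`
(`Δ = M√(ρℓ³) ≥ 1` from `1 ≤ M`, `M² ≤ ρℓ³`) and bound each one-sided infimum by the corresponding
one-sided stub. Each one-sided stub is a strict special case of the crux (vanishing off the overfull set
implies vanishing on the window), and the crux is equivalent to their conjunction given the splitting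
lemma — so a refutation of either half refutes the crux (refutation proxies), and neither half alone,
nor the splitting lemma, gives the crux or the summit cheaply (BC3 probes, NOTES.md of the registrar).

Disproof used: none on file for this crux (`ledger crux ls`: no `Disproof.lean` yet); negatives index
entries of the route (SwapJensen, BerryStiffPhaseLRO) are unrelated to cell-count gaps.
-/

noncomputable section

namespace Summit.AtomisticToContinuum.BoseEinsteinCondensation.Cruxes.CountViolationGapU.Birth

open Literature.MathematicalPhysics.QuantumManyBody.BoseGas
open scoped ENNReal
open Filter

/-! ## Vocabulary (abbreviations of sub-expressions of the crux body) -/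

/-- The particle number `N_Q(X) = #{j : X_j ∈ Q}` of the configuration `X` in the half-open cell
`Q = ∏ₖ [x₀ k, x₀ k + ℓ)` — literally the sum of indicators appearing in `CountViolationGapU`. -/
def cellCount {N : ℕ} (x₀ : EuclideanSpace ℝ (Fin 3)) (ℓ : ℝ) (X : Config N) : ℝ :=
  ∑ j : Fin N, ({x : EuclideanSpace ℝ (Fin 3) | ∀ k, x k ∈ Set.Ico (x₀ k) (x₀ k + ℓ)}).indicator
    (fun _ => (1 : ℝ)) (X j)

/-- The OVERFULL one-sided variational infimum: the least energy of a Dirichlet trial state supported in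
the compressed configurations `{N_Q − n̄ > Δ}`, i.e. vanishing wherever `N_Q − n̄ ≤ Δ`. -/
def overfullInf (v : ℝ → ℝ≥0∞) (N : ℕ) (L : ℝ) (x₀ : EuclideanSpace ℝ (Fin 3)) (ℓ nbar Δ : ℝ) :
    ℝ≥0∞ :=
  ⨅ (Φ : TrialState N L) (_ : ∀ X : Config N, cellCount x₀ ℓ X - nbar ≤ Δ → Φ.ψ X = 0), energy v Φ

/-- The UNDERFULL one-sided variational infimum: the least energy of a Dirichlet trial state supported in
the rarefied configurations `{N_Q − n̄ < −Δ}`, i.e. vanishing wherever `−Δ ≤ N_Q − n̄`. -/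
def underfullInf (v : ℝ → ℝ≥0∞) (N : ℕ) (L : ℝ) (x₀ : EuclideanSpace ℝ (Fin 3)) (ℓ nbar Δ : ℝ) :
    ℝ≥0∞ :=
  ⨅ (Φ : TrialState N L) (_ : ∀ X : Config N, -Δ ≤ cellCount x₀ ℓ X - nbar → Φ.ψ X = 0), energy v Φ

/-! ## The three stub statements -/

/-- **Stub 1 statement — support splitting across the count window.** For any pair potential `v`, any
`N`, `L`, cell `x₀ + [0,ℓ)³`, nominal count `n̄` and half-width `Δ ≥ 1` (so the band `[n̄ − Δ, n̄ + Δ]`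
contains an integer): a Dirichlet trial state vanishing on the window `{|N_Q − n̄| ≤ Δ}` has energy at
least `min(overfullInf, underfullInf)`. (Piecewise-`C¹` splitting `Φ = Φ·1_{overfull} + Φ·1_{underfull}`;
see the module docstring.) -/
def SupportSplit : Prop :=
  ∀ (v : ℝ → ℝ≥0∞) (N : ℕ) (L : ℝ) (x₀ : EuclideanSpace ℝ (Fin 3)) (ℓ nbar Δ : ℝ), 1 ≤ Δ →
    ∀ Φ : TrialState N L, (∀ X : Config N, |cellCount x₀ ℓ X - nbar| ≤ Δ → Φ.ψ X = 0) →
      min (overfullInf v N L x₀ ℓ nbar Δ) (underfullInf v N L x₀ ℓ nbar Δ) ≤ energy v Φ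

/-- **Stub 2 statement — the compression (overfull) half of the gap**, with the crux's quantifier
prefix verbatim (`K₀`, `ρ₀` after `v`; `c₀` after `ρ`; `N`-threshold after `ρ`, before `K`; cap
`K ≤ log N`; interior cells; `1 ≤ M ≤ √(ρℓ³)`): every Dirichlet trial state vanishing wherever
`N_Q − ρℓ³ ≤ M√(ρℓ³)` (i.e. supported in the overfull configurations) has energy
`≥ E₀(N,L) + c₀·a·ρ·M²`. -/
def OverfullGapU : Prop :=
  ∀ v : ℝ → ℝ≥0∞, IsRepulsiveFiniteRange v → ∃ K₀ ρ₀ : ℝ, 0 < ρ₀ ∧ ∀ ρ : ℝ, 0 < ρ → ρ < ρ₀ →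
    ∃ c₀ : ℝ, 0 < c₀ ∧ ∀ᶠ N : ℕ in atTop, ∀ K : ℝ, K₀ ≤ K → K ≤ Real.log N →
      let a : ℝ := (scatteringLength v).toReal
      let ℓ : ℝ := K * (ρ * a) ^ (-(1 / 2 : ℝ))
      let L : ℝ := sideLength ρ N
      3 * ℓ ≤ L → ∀ x₀ : EuclideanSpace ℝ (Fin 3), (∀ k, ℓ ≤ x₀ k ∧ x₀ k + 2 * ℓ ≤ L) →
        ∀ M : ℝ, 1 ≤ M → M ^ 2 ≤ ρ * ℓ ^ 3 → ∀ Φ : TrialState N L,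
          (∀ X : Config N, cellCount x₀ ℓ X - ρ * ℓ ^ 3 ≤ M * Real.sqrt (ρ * ℓ ^ 3) → Φ.ψ X = 0) →
            groundStateEnergy v N L + ENNReal.ofReal (c₀ * a * ρ * M ^ 2) ≤ energy v Φ

/-- **Stub 3 statement — the rarefaction (underfull / void) half of the gap**, same prefix: every
Dirichlet trial state vanishing wherever `−M√(ρℓ³) ≤ N_Q − ρℓ³` (i.e. supported in the underfull
configurations) has energy `≥ E₀(N,L) + c₀·a·ρ·M²`. -/
def UnderfullGapU : Prop :=
  ∀ v : ℝ → ℝ≥0∞, IsRepulsiveFiniteRange v → ∃ K₀ ρ₀ : ℝ, 0 < ρ₀ ∧ ∀ ρ : ℝ, 0 < ρ → ρ < ρ₀ →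
    ∃ c₀ : ℝ, 0 < c₀ ∧ ∀ᶠ N : ℕ in atTop, ∀ K : ℝ, K₀ ≤ K → K ≤ Real.log N →
      let a : ℝ := (scatteringLength v).toReal
      let ℓ : ℝ := K * (ρ * a) ^ (-(1 / 2 : ℝ))
      let L : ℝ := sideLength ρ N
      3 * ℓ ≤ L → ∀ x₀ : EuclideanSpace ℝ (Fin 3), (∀ k, ℓ ≤ x₀ k ∧ x₀ k + 2 * ℓ ≤ L) →
        ∀ M : ℝ, 1 ≤ M → M ^ 2 ≤ ρ * ℓ ^ 3 → ∀ Φ : TrialState N L,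
          (∀ X : Config N, -(M * Real.sqrt (ρ * ℓ ^ 3)) ≤ cellCount x₀ ℓ X - ρ * ℓ ^ 3 → Φ.ψ X = 0) →
            groundStateEnergy v N L + ENNReal.ofReal (c₀ * a * ρ * M ^ 2) ≤ energy v Φ

/-! ## Registered stubs -/

/-- **Stub 1 (M, analysis): support splitting.** See `SupportSplit`. -/
theorem stub_supportSplit : SupportSplit := by
  sorry

/-- **Stub 2 (XL): compression half of the count-violation gap.** See `OverfullGapU`. -/
theorem stub_overfullGap : OverfullGapU := by
  sorry

/-- **Stub 3 (XL): rarefaction / void half of the count-violation gap.** See `UnderfullGapU`. -/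
theorem stub_underfullGap : UnderfullGapU := by
  sorry

/-! ## Composition (kernel-checked, no `sorry`) -/

/-- Monotonicity of the increment in the constant: `c ≤ c'` gives `c·aρM² ≤ c'·aρM²` in `ℝ≥0∞`. -/
theorem ofReal_const_mul_le {c c' t : ℝ} (h : c ≤ c') (ht : 0 ≤ t) :
    ENNReal.ofReal (c * t) ≤ ENNReal.ofReal (c' * t) :=
  ENNReal.ofReal_le_ofReal (mul_le_mul_of_nonneg_right h ht)

/-- **The composition.** The three stubs imply the crux `CountViolationGapU` BY NAME:
`K₀ = max K₊ K₋`, `ρ₀ = min ρ₊ ρ₋`, `c₀(ρ) = min (c₊ ρ) (c₋ ρ)`, the `N`-eventualities intersected;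
for a state vanishing on the window, `stub_supportSplit` (with `Δ = M√(ρℓ³) ≥ 1`) bounds its energy
below by the smaller one-sided infimum, and each one-sided infimum is `≥ E₀ + c₀aρM²` by the
corresponding one-sided stub applied to every competitor. -/
theorem CountViolationGapU_of (hS : SupportSplit) (hO : OverfullGapU) (hU : UnderfullGapU) :
    Summit.AtomisticToContinuum.BoseEinsteinCondensation.Theses.BECStoquasticCensoring.CountViolationGapU := by
  intro v hv
  obtain ⟨K₁, ρ₁, hρ₁, h₁⟩ := hO v hv
  obtain ⟨K₂, ρ₂, hρ₂, h₂⟩ := hU v hv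
  refine ⟨max K₁ K₂, min ρ₁ ρ₂, lt_min hρ₁ hρ₂, fun ρ hρ hρlt => ?_⟩
  obtain ⟨c₁, hc₁, hev₁⟩ := h₁ ρ hρ (hρlt.trans_le (min_le_left _ _))
  obtain ⟨c₂, hc₂, hev₂⟩ := h₂ ρ hρ (hρlt.trans_le (min_le_right _ _))
  refine ⟨min c₁ c₂, lt_min hc₁ hc₂, ?_⟩
  filter_upwards [hev₁, hev₂] with N hN₁ hN₂
  intro K hK hKlog
  have hK₁ : K₁ ≤ K := (le_max_left _ _).trans hK
  have hK₂ : K₂ ≤ K := (le_max_right _ _).trans hK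
  have hN₁K := hN₁ K hK₁ hKlog
  have hN₂K := hN₂ K hK₂ hKlog
  intro a ℓ L h3 x₀ hx₀ M hM hM2 Φ hΦ
  -- the window half-width `Δ = M √(ρ ℓ³)` is at least `1`
  have hsqrt : 1 ≤ Real.sqrt (ρ * ℓ ^ 3) := by
    calc (1 : ℝ) ≤ M := hM
      _ = Real.sqrt (M ^ 2) := (Real.sqrt_sq (by linarith)).symm
      _ ≤ Real.sqrt (ρ * ℓ ^ 3) := Real.sqrt_le_sqrt hM2
  have hΔ : 1 ≤ M * Real.sqrt (ρ * ℓ ^ 3) := one_le_mul_of_one_le_of_one_le hM hsqrt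
  -- nonnegativity of the increment scale `a ρ M²`
  have ha : 0 ≤ a := ENNReal.toReal_nonneg
  have ht : 0 ≤ a * ρ * M ^ 2 := mul_nonneg (mul_nonneg ha hρ.le) (sq_nonneg M)
  have hmono : ∀ {c c' : ℝ}, c ≤ c' →
      ENNReal.ofReal (c * a * ρ * M ^ 2) ≤ ENNReal.ofReal (c' * a * ρ * M ^ 2) := by
    intro c c' h
    have := ofReal_const_mul_le h ht
    simpa only [mul_assoc] using this
  -- split the support of `Φ` across the window
  have hsplit := hS v N L x₀ ℓ (ρ * ℓ ^ 3) (M * Real.sqrt (ρ * ℓ ^ 3)) hΔ Φ hΦ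
  refine le_trans (le_min ?_ ?_) hsplit
  · -- compression half
    refine le_iInf₂ fun Φ' hΦ' => ?_
    calc groundStateEnergy v N L + ENNReal.ofReal (min c₁ c₂ * a * ρ * M ^ 2)
        ≤ groundStateEnergy v N L + ENNReal.ofReal (c₁ * a * ρ * M ^ 2) :=
          add_le_add le_rfl (hmono (min_le_left _ _))
      _ ≤ energy v Φ' := hN₁K h3 x₀ hx₀ M hM hM2 Φ' hΦ'
  · -- rarefaction half
    refine le_iInf₂ fun Φ' hΦ' => ?_
    calc groundStateEnergy v N L + ENNReal.ofReal (min c₁ c₂ * a * ρ * M ^ 2)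
        ≤ groundStateEnergy v N L + ENNReal.ofReal (c₂ * a * ρ * M ^ 2) :=
          add_le_add le_rfl (hmono (min_le_right _ _))
      _ ≤ energy v Φ' := hN₂K h3 x₀ hx₀ M hM hM2 Φ' hΦ'

/-- **The crux from the registered stubs** (closes `CountViolationGapU` BY NAME once the three
`stub_*` are proved; until then its axiom closure shows `sorryAx` through the stubs only). -/
theorem countViolationGapU_of_registered_stubs :
    Summit.AtomisticToContinuum.BoseEinsteinCondensation.Theses.BECStoquasticCensoring.CountViolationGapU :=
  CountViolationGapU_of stub_supportSplit stub_overfullGap stub_underfullGap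

end Summit.AtomisticToContinuum.BoseEinsteinCondensation.Cruxes.CountViolationGapU.Birth

end
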